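import Mathlib
import Summits.MatrixMultiplication.MatrixMultiplication.Theses.FieldSumsetRank
import Summits.MatrixMultiplication.MatrixMultiplication.Theses.BorderRankLowerBound
import Summits.MatrixMultiplication.MatrixMultiplication.Theses.AsymptoticSpectrum
import Summits.MatrixMultiplication.MatrixMultiplication.Theorems.FieldSumsetRankUpperSandwich
import Summits.MatrixMultiplication.MatrixMultiplication.Theorems.FieldSumsetRankLowerSandwich
import Summits.MatrixMultiplication.MatrixMultiplication.Theorems.AsymptoticSpectrumOmegaGeTwo
import Literature.Computability.AlgebraicComplexity.MatrixMultiplicationExponentInf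
import Literature.Computability.AlgebraicComplexity.AsymptoticRankMatMul

/-!
# Crux `HostingSuperquadratic` (stmt-MatrixMultiplication-8734) — strategist's typed companion

Route `FieldSumsetRank` (refutation line). This file is the kernel-checked companion of
`STRATEGY-CENSUS.md` (crux-strategist, RESTATED re-audit, 2026-08-17). It contains NO `sorry`.

Contents.

* §1  The exact position of the crux: `C ↔ FThesis (stmt-0652) ↔ 2 < ω(ℂ) ↔ ¬ MatrixMultiplication`
      (`crux_iff_fthesis`, `crux_iff_two_lt_omega`, `crux_iff_not_statement`). The one-crux audit said
      "equivalent up to a factor 2"; it is equivalent on the nose.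
* §2  SANDWICH UNIVERSALITY (the obstruction to every in-language split): interpolated algorithms are
      hostings inside the progression pair `(ℂ[t]_{<r}, ℂ[t]_{<r})`, `r = R(⟨n,n,n⟩)`
      (`upperSandwichDeg`), so the rigidity statement for the MOST structured class any inverse
      sumset theorem can output — "no hosting inside a short progression pair",
      `ProgHostingSuperquadratic` — is already equivalent to `FThesis` (`progHosting_iff_fthesis`),
      and every rigidity piece whose class contains the progression-pair hostings implies it
      (`fthesis_of_rigidity`, `crux_of_rigidity`). Decomposition D-A of the census.
* §3  The growth split D-C: `C ↔ HostingBeatsEveryConstant ∧ NoIntermediateGrowth` is exact but its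
      second piece is `X₁ → C` (a seam), `crux_iff_growth_split`.
* §4  The one split found that passes BC2 (a)(b)(c) formally, D-N, OUTSIDE the route's language:
      `NotFormatBound ∧ MMUniversality → C` (`crux_of_universality_split`, a real proof through
      `2 < ω`), with `NotFormatBound` a consequence of `C` (`notFormatBound_of_two_lt_omega`, given
      Strassen duality) and `MMUniversality` a consequence of the extended asymptotic rank conjecture
      (`mmUniversality_of_formatBound`), hence incomparable with `C`.
* §5  Typed statements of the other census entries (transfer / strengthen / normal forms), no proofs.
-/

set_option linter.unusedVariables false
set_option linter.dupNamespace false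

noncomputable section

namespace Summit.MatrixMultiplication.MatrixMultiplication.Cruxes.HostingSuperquadratic.Strategist

open scoped BigOperators
open Polynomial Filter
open Literature.Computability.AlgebraicComplexity
open Summit.MatrixMultiplication.MatrixMultiplication.Theses
open Summit.MatrixMultiplication.MatrixMultiplication.Theorems

/-- The crux, by name. -/
abbrev C : Prop := FieldSumsetRank.HostingSuperquadratic

/-- The target of route BorderRankLowerBound (stmt-0652), by name. -/
abbrev FThesis : Prop := BorderRankLowerBound.FThesis

/-! ## §1 The exact position of the crux -/

/-- `C → FThesis`: a rank-`R` algorithm interpolated at `R` nodes is a hosting of cost `≤ 2R − 1`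
(`UpperSandwich`, landed), so the hosting bound `c·n^{2+δ}` gives `R ≥ (c/2)·n^{2+δ}`. -/
theorem fthesis_of_crux : C → FThesis := by
  rintro ⟨δ, hδ, c, hc, hX⟩
  refine ⟨δ, hδ, c / 2, by positivity, ?_⟩
  intro n hn
  obtain ⟨α, β, γ, hhost, hdim⟩ := upperSandwich_proof n _ le_rfl
  have h1 := hX n hn α β γ hhost
  have h3 : Module.finrank ℂ ↥(LinearMap.range α * LinearMap.range β)
      ≤ 2 * tensorRank (matMulTensor ℂ n n n) := hdim.trans (Nat.sub_le _ _)
  have h2 : (Module.finrank ℂ ↥(LinearMap.range α * LinearMap.range β) : ℝ)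
      ≤ 2 * (tensorRank (matMulTensor ℂ n n n) : ℝ) := by exact_mod_cast h3
  linarith

/-- `FThesis → C`: a hosting of cost `p` evaluated at `p` interpolation nodes is a rank-`p`
algorithm (`LowerSandwich`, landed), so `cost ≥ R ≥ c·n^{2+δ}`. -/
theorem crux_of_fthesis : FThesis → C := by
  rintro ⟨δ, hδ, c, hc, hR⟩
  refine ⟨δ, hδ, c, hc, ?_⟩
  intro n hn α β γ hhost
  have h1 := hR n hn
  have h2 : (tensorRank (matMulTensor ℂ n n n) : ℝ)
      ≤ (Module.finrank ℂ ↥(LinearMap.range α * LinearMap.range β) : ℝ) := by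
    exact_mod_cast lowerSandwich_proof n α β γ hhost
  linarith

/-- The crux IS the target of BorderRankLowerBound (stmt-0652), exactly. -/
theorem crux_iff_fthesis : C ↔ FThesis := ⟨fthesis_of_crux, crux_of_fthesis⟩

/-- `FThesis → 2 < ω(ℂ)` (landed assembly of BorderRankLowerBound plus `2 ≤ ω`). -/
theorem two_lt_omega_of_fthesis : FThesis → 2 < omega ℂ := by
  intro h
  have hne : ¬ omega ℂ = 2 := by
    have := Literature.not_matrixMultiplication_of_superquadratic_rank h
    rwa [_root_.MatrixMultiplication_iff] at this
  exact lt_of_le_of_ne (Literature.CplxAlg.two_le_omega ℂ) (Ne.symm hne)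

/-- `2 < ω(ℂ) → FThesis`: `R(⟨n,n,n⟩) ≥ n^ω` for every `n ≥ 2` (`ω ≤ log_n R(⟨n,n,n⟩)`, tree), so
`δ := ω − 2`, `c := 1` works (`n = 1`: `R(⟨1,1,1⟩) ≥ 1`). Lower bounds do not need to amplify:
the infimum definition of `ω` already makes every `R(⟨n,n,n⟩)` at least `n^ω`. -/
theorem fthesis_of_two_lt_omega : 2 < omega ℂ → FThesis := by
  intro hω
  refine ⟨omega ℂ - 2, by linarith, 1, one_pos, ?_⟩
  intro n hn
  rw [one_mul, show (2 : ℝ) + (omega ℂ - 2) = omega ℂ by ring]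
  rcases Nat.lt_or_ge n 2 with hlt | hge
  · -- n = 1
    have hn1 : n = 1 := by omega
    subst hn1
    have h1 : 1 ≤ tensorRank (matMulTensor ℂ 1 1 1) := by
      simpa using matMulTensor_sq_le_tensorRank ℂ 1
    have h1' : (1 : ℝ) ≤ (tensorRank (matMulTensor ℂ 1 1 1) : ℝ) := by exact_mod_cast h1
    simpa using h1'
  · have hlog := omega_le_logb_tensorRank_matMulTensor ℂ hge
    have hnpos : (0 : ℝ) < n := by exact_mod_cast (by omega : 0 < n)
    have hn1 : (1 : ℝ) ≤ n := by exact_mod_cast (by omega : 1 ≤ n)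
    have hn1' : (n : ℝ) ≠ 1 := by
      have : (1 : ℝ) < n := by exact_mod_cast (by omega : 1 < n)
      exact ne_of_gt this
    have hRpos : (0 : ℝ) < tensorRank (matMulTensor ℂ n n n) := tensorRank_matMulTensor_pos ℂ hge
    calc (n : ℝ) ^ omega ℂ
        ≤ (n : ℝ) ^ Real.logb n (tensorRank (matMulTensor ℂ n n n)) :=
          Real.rpow_le_rpow_of_exponent_le hn1 hlog
      _ = tensorRank (matMulTensor ℂ n n n) := Real.rpow_logb hnpos hn1' hRpos

/-- The crux is `ω(ℂ) > 2`, exactly. -/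
theorem crux_iff_two_lt_omega : C ↔ 2 < omega ℂ :=
  ⟨fun h => two_lt_omega_of_fthesis (fthesis_of_crux h),
    fun h => crux_of_fthesis (fthesis_of_two_lt_omega h)⟩

/-- The crux is the NEGATION OF THE SUMMIT, exactly (given the landed `2 ≤ ω(ℂ)`). -/
theorem crux_iff_not_statement : C ↔ ¬ _root_.MatrixMultiplication := by
  rw [crux_iff_two_lt_omega, _root_.MatrixMultiplication_iff]
  constructor
  · intro h h2
    rw [h2] at h
    exact lt_irrefl _ h
  · intro h
    exact lt_of_le_of_ne (Literature.CplxAlg.two_le_omega ℂ) (Ne.symm h)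

/-! ## §2 Sandwich universality: the rigidity half of every inverse-theorem split is `FThesis` -/

/-- `UpperSandwich` with the host EXPOSED: a rank-`r` algorithm interpolated at the nodes
`0, …, r − 1` is a hosting whose two spaces lie in the progression `ℂ[t]_{<r}`. (Same construction as
the landed `upperSandwich_proof`; only the conclusion is sharpened.) -/
theorem upperSandwichDeg (n r : ℕ) (hr : tensorRank (matMulTensor ℂ n n n) ≤ r) :
    ∃ (α β : Matrix (Fin n) (Fin n) ℂ →ₗ[ℂ] ℂ[X]) (γ : ℂ[X] →ₗ[ℂ] Matrix (Fin n) (Fin n) ℂ),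
      (∀ X Y, γ (α X * β Y) = X * Y) ∧ LinearMap.range α ≤ Polynomial.degreeLT ℂ r ∧
        LinearMap.range β ≤ Polynomial.degreeLT ℂ r := by
  classical
  obtain ⟨w, u, v, hdec⟩ := (tensorRank_le_iff (matMulTensor ℂ n n n) r).1 hr
  let node : Fin r → ℂ := fun i => ((i : ℕ) : ℂ)
  have hnode : Set.InjOn node (Finset.univ : Finset (Fin r)) :=
    (Nat.cast_injective.comp Fin.val_injective).injOn
  let Lu : Matrix (Fin n) (Fin n) ℂ →ₗ[ℂ] (Fin r → ℂ) :=
    LinearMap.pi fun ρ => ∑ ij : Fin n × Fin n, u ρ ij • Matrix.entryLinearMap ℂ ℂ ij.1 ij.2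
  let Lv : Matrix (Fin n) (Fin n) ℂ →ₗ[ℂ] (Fin r → ℂ) :=
    LinearMap.pi fun ρ => ∑ jl : Fin n × Fin n, v ρ jl • Matrix.entryLinearMap ℂ ℂ jl.1 jl.2
  let W : Fin r → Matrix (Fin n) (Fin n) ℂ := fun ρ => Matrix.of fun κ ν => w ρ (κ, ν)
  let α : Matrix (Fin n) (Fin n) ℂ →ₗ[ℂ] ℂ[X] := (Lagrange.interpolate Finset.univ node) ∘ₗ Lu
  let β : Matrix (Fin n) (Fin n) ℂ →ₗ[ℂ] ℂ[X] := (Lagrange.interpolate Finset.univ node) ∘ₗ Lv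
  let γ : ℂ[X] →ₗ[ℂ] Matrix (Fin n) (Fin n) ℂ :=
    ∑ ρ : Fin r, (Polynomial.leval (node ρ)).smulRight (W ρ)
  have hLu : ∀ X ρ, Lu X ρ = ∑ ij : Fin n × Fin n, u ρ ij • X ij.1 ij.2 := by
    intro X ρ
    simp [Lu, LinearMap.pi_apply, LinearMap.sum_apply, LinearMap.smul_apply,
      Matrix.entryLinearMap_apply]
  have hLv : ∀ Y ρ, Lv Y ρ = ∑ jl : Fin n × Fin n, v ρ jl • Y jl.1 jl.2 := by
    intro Y ρ
    simp [Lv, LinearMap.pi_apply, LinearMap.sum_apply, LinearMap.smul_apply,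
      Matrix.entryLinearMap_apply]
  have hαeval : ∀ X ρ, (α X).eval (node ρ) = ∑ ij : Fin n × Fin n, u ρ ij • X ij.1 ij.2 := by
    intro X ρ
    change (Lagrange.interpolate Finset.univ node (Lu X)).eval (node ρ) = _
    rw [Lagrange.eval_interpolate_at_node _ hnode (Finset.mem_univ ρ), hLu]
  have hβeval : ∀ Y ρ, (β Y).eval (node ρ) = ∑ jl : Fin n × Fin n, v ρ jl • Y jl.1 jl.2 := by
    intro Y ρ
    change (Lagrange.interpolate Finset.univ node (Lv Y)).eval (node ρ) = _
    rw [Lagrange.eval_interpolate_at_node _ hnode (Finset.mem_univ ρ), hLv]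
  have hαdeg : ∀ X, (α X).degree < r := by
    intro X
    change (Lagrange.interpolate Finset.univ node (Lu X)).degree < _
    have h := Lagrange.degree_interpolate_lt (Lu X) hnode
    rwa [Finset.card_univ, Fintype.card_fin] at h
  have hβdeg : ∀ Y, (β Y).degree < r := by
    intro Y
    change (Lagrange.interpolate Finset.univ node (Lv Y)).degree < _
    have h := Lagrange.degree_interpolate_lt (Lv Y) hnode
    rwa [Finset.card_univ, Fintype.card_fin] at h
  have hγ : ∀ p : ℂ[X], γ p = ∑ ρ, p.eval (node ρ) • W ρ := by
    intro p
    simp [γ, LinearMap.sum_apply, LinearMap.smulRight_apply, Polynomial.leval_apply]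
  refine ⟨α, β, γ, ?_, ?_, ?_⟩
  · intro X Y
    rw [hγ]
    ext κ ν
    have key := sum_smul_linForm_mul_linForm_eq (R := ℂ) hdec
      (fun ij : Fin n × Fin n => X ij.1 ij.2) (fun jl : Fin n × Fin n => Y jl.1 jl.2) κ ν
    rw [Matrix.mul_apply, ← key, Matrix.sum_apply]
    refine Finset.sum_congr rfl fun ρ _ => ?_
    rw [Matrix.smul_apply, Polynomial.eval_mul, hαeval, hβeval]
    simp only [W, Matrix.of_apply, smul_eq_mul]
    ring
  · rintro p ⟨X, rfl⟩
    exact Polynomial.mem_degreeLT.2 (hαdeg X)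
  · rintro p ⟨Y, rfl⟩
    exact Polynomial.mem_degreeLT.2 (hβdeg Y)

/-- A hosting inside the progression pair `(ℂ[t]_{<r}, ℂ[t]_{<r})` has cost `≤ 2r − 1`. -/
theorem cost_le_of_progression {n r : ℕ} (α β : Matrix (Fin n) (Fin n) ℂ →ₗ[ℂ] ℂ[X])
    (hα : LinearMap.range α ≤ Polynomial.degreeLT ℂ r)
    (hβ : LinearMap.range β ≤ Polynomial.degreeLT ℂ r) :
    Module.finrank ℂ ↥(LinearMap.range α * LinearMap.range β) ≤ 2 * r - 1 := by
  have hle : LinearMap.range α * LinearMap.range β ≤ Polynomial.degreeLT ℂ (2 * r - 1) := by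
    rw [Submodule.mul_le]
    intro p hp q hq
    exact fieldSumsetRank_mul_mem_degreeLT (Polynomial.mem_degreeLT.1 (hα hp))
      (Polynomial.mem_degreeLT.1 (hβ hq))
  calc Module.finrank ℂ ↥(LinearMap.range α * LinearMap.range β)
      ≤ Module.finrank ℂ ↥(Polynomial.degreeLT ℂ (2 * r - 1)) := Submodule.finrank_mono hle
    _ = 2 * r - 1 := fieldSumsetRank_finrank_degreeLT _

/-- **The rigidity statement for the most structured class** ("dilated progressions" of the
route's two-layer plan, in the extreme form any inverse theorem can return): `⟨n,n,n⟩` is not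
hosted inside a progression pair `(ℂ[t]_{<r}, ℂ[t]_{<r})` unless `r ≥ c·n^{2+δ}`. -/
def ProgHostingSuperquadratic : Prop :=
  ∃ δ : ℝ, 0 < δ ∧ ∃ c : ℝ, 0 < c ∧ ∀ n : ℕ, 1 ≤ n → ∀ r : ℕ,
    ∀ (α β : Matrix (Fin n) (Fin n) ℂ →ₗ[ℂ] ℂ[X]) (γ : ℂ[X] →ₗ[ℂ] Matrix (Fin n) (Fin n) ℂ),
      (∀ X Y, γ (α X * β Y) = X * Y) → LinearMap.range α ≤ Polynomial.degreeLT ℂ r →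
        LinearMap.range β ≤ Polynomial.degreeLT ℂ r → c * (n : ℝ) ^ (2 + δ) ≤ r

/-- `ProgHostingSuperquadratic → FThesis`: apply it to the interpolated host of an optimal
algorithm (`upperSandwichDeg` with `r = R(⟨n,n,n⟩)`). -/
theorem fthesis_of_progHosting : ProgHostingSuperquadratic → FThesis := by
  rintro ⟨δ, hδ, c, hc, h⟩
  refine ⟨δ, hδ, c, hc, ?_⟩
  intro n hn
  obtain ⟨α, β, γ, hhost, hα, hβ⟩ := upperSandwichDeg n _ le_rfl
  exact h n hn _ α β γ hhost hα hβ

/-- `FThesis → ProgHostingSuperquadratic`: a progression-pair hosting has cost `≤ 2r − 1` and cost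
`≥ R(⟨n,n,n⟩)` (`LowerSandwich`, landed). -/
theorem progHosting_of_fthesis : FThesis → ProgHostingSuperquadratic := by
  rintro ⟨δ, hδ, c, hc, hR⟩
  refine ⟨δ, hδ, c / 2, by positivity, ?_⟩
  intro n hn r α β γ hhost hα hβ
  have h1 := hR n hn
  have h2 : tensorRank (matMulTensor ℂ n n n) ≤ 2 * r - 1 :=
    (lowerSandwich_proof n α β γ hhost).trans (cost_le_of_progression α β hα hβ)
  have h3 : tensorRank (matMulTensor ℂ n n n) ≤ 2 * r := h2.trans (Nat.sub_le _ _)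
  have h4 : (tensorRank (matMulTensor ℂ n n n) : ℝ) ≤ 2 * (r : ℝ) := by exact_mod_cast h3
  linarith

/-- **D-A certificate.** The rigidity piece for progression-pair hosts is already the whole crux. -/
theorem progHosting_iff_fthesis : ProgHostingSuperquadratic ↔ FThesis :=
  ⟨fthesis_of_progHosting, progHosting_of_fthesis⟩

/-- `ProgHostingSuperquadratic ↔ C`. -/
theorem progHosting_iff_crux : ProgHostingSuperquadratic ↔ C :=
  progHosting_iff_fthesis.trans crux_iff_fthesis.symm

/-- A RIGIDITY PIECE for a class `P` of hostings (any predicate on `(n, α, β, γ)`): every hosting in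
the class costs `≥ c·n^{2+δ}`. -/
def RigidityFor
    (P : ∀ n : ℕ, (Matrix (Fin n) (Fin n) ℂ →ₗ[ℂ] ℂ[X]) → (Matrix (Fin n) (Fin n) ℂ →ₗ[ℂ] ℂ[X]) →
      (ℂ[X] →ₗ[ℂ] Matrix (Fin n) (Fin n) ℂ) → Prop) : Prop :=
  ∃ δ : ℝ, 0 < δ ∧ ∃ c : ℝ, 0 < c ∧ ∀ n : ℕ, 1 ≤ n →
    ∀ (α β : Matrix (Fin n) (Fin n) ℂ →ₗ[ℂ] ℂ[X]) (γ : ℂ[X] →ₗ[ℂ] Matrix (Fin n) (Fin n) ℂ),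
      (∀ X Y, γ (α X * β Y) = X * Y) → P n α β γ →
        c * (n : ℝ) ^ (2 + δ) ≤ (Module.finrank ℂ ↥(LinearMap.range α * LinearMap.range β) : ℝ)

/-- The class `P` CONTAINS THE PROGRESSION-PAIR HOSTS: every hosting with both spaces inside some
`ℂ[t]_{<r}`, `r ≤ 2·cost` (the density any inverse theorem at doubling `K` must allow, since a pair
inside progressions of length `r` has doubling `≤ 2r/n²`), is in `P`. Every output class of a
Freiman-type theorem ("contained in a dilated progression of length `O_K(N)`") has this property
after the dilation is cleared. -/
def ContainsProgressionHosts
    (P : ∀ n : ℕ, (Matrix (Fin n) (Fin n) ℂ →ₗ[ℂ] ℂ[X]) → (Matrix (Fin n) (Fin n) ℂ →ₗ[ℂ] ℂ[X]) →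
      (ℂ[X] →ₗ[ℂ] Matrix (Fin n) (Fin n) ℂ) → Prop) : Prop :=
  ∀ (n r : ℕ) (α β : Matrix (Fin n) (Fin n) ℂ →ₗ[ℂ] ℂ[X]) (γ : ℂ[X] →ₗ[ℂ] Matrix (Fin n) (Fin n) ℂ),
    (∀ X Y, γ (α X * β Y) = X * Y) → LinearMap.range α ≤ Polynomial.degreeLT ℂ r →
      LinearMap.range β ≤ Polynomial.degreeLT ℂ r →
        r ≤ 2 * Module.finrank ℂ ↥(LinearMap.range α * LinearMap.range β) → P n α β γ

/-- In an interpolated hosting the host length `r = R(⟨n,n,n⟩)` is at most the cost (LowerSandwich),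
so the density hypothesis of `ContainsProgressionHosts` is met with room to spare. Hence:
**every rigidity piece over a class containing the progression-pair hosts implies `FThesis`**, i.e.
is `≥` the crux — decomposition D-A cannot have an honest rigidity half. -/
theorem fthesis_of_rigidity
    (P : ∀ n : ℕ, (Matrix (Fin n) (Fin n) ℂ →ₗ[ℂ] ℂ[X]) → (Matrix (Fin n) (Fin n) ℂ →ₗ[ℂ] ℂ[X]) →
      (ℂ[X] →ₗ[ℂ] Matrix (Fin n) (Fin n) ℂ) → Prop)
    (hP : ContainsProgressionHosts P) (hR : RigidityFor P) : FThesis := by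
  obtain ⟨δ, hδ, c, hc, h⟩ := hR
  refine ⟨δ, hδ, c / 2, by positivity, ?_⟩
  intro n hn
  obtain ⟨α, β, γ, hhost, hα, hβ⟩ := upperSandwichDeg n _ le_rfl
  have hlow := lowerSandwich_proof n α β γ hhost
  have hmem : P n α β γ := hP n _ α β γ hhost hα hβ (by omega)
  have h1 := h n hn α β γ hhost hmem
  have hcost : Module.finrank ℂ ↥(LinearMap.range α * LinearMap.range β)
      ≤ 2 * tensorRank (matMulTensor ℂ n n n) :=
    (cost_le_of_progression α β hα hβ).trans (Nat.sub_le _ _)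
  have h2 : (Module.finrank ℂ ↥(LinearMap.range α * LinearMap.range β) : ℝ)
      ≤ 2 * (tensorRank (matMulTensor ℂ n n n) : ℝ) := by exact_mod_cast hcost
  linarith

/-- Corollary: such a rigidity piece implies the crux itself. -/
theorem crux_of_rigidity
    (P : ∀ n : ℕ, (Matrix (Fin n) (Fin n) ℂ →ₗ[ℂ] ℂ[X]) → (Matrix (Fin n) (Fin n) ℂ →ₗ[ℂ] ℂ[X]) →
      (ℂ[X] →ₗ[ℂ] Matrix (Fin n) (Fin n) ℂ) → Prop)
    (hP : ContainsProgressionHosts P) (hR : RigidityFor P) : C :=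
  crux_of_fthesis (fthesis_of_rigidity P hP hR)

/-! ## §3 The growth split (D-C): exact, but a seam -/

/-- "Hosting beats every constant": `cost(n)/n² → ∞`. Strictly weaker than the crux (it allows
`cost ≍ n² log n`), equivalent through the sandwiches to `R(⟨n,n,n⟩)/n² → ∞`, itself open (record
`3n² − o(n²)`); it is `FBeatThreeNSquared` (stmt-0654) / `HostingBeatsSix` (stmt-8737) for every
constant at once. -/
def HostingBeatsEveryConstant : Prop :=
  ∀ K : ℝ, ∀ᶠ n : ℕ in atTop,
    ∀ (α β : Matrix (Fin n) (Fin n) ℂ →ₗ[ℂ] ℂ[X]) (γ : ℂ[X] →ₗ[ℂ] Matrix (Fin n) (Fin n) ℂ),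
      (∀ X Y, γ (α X * β Y) = X * Y) →
        K * (n : ℝ) ^ 2 ≤ (Module.finrank ℂ ↥(LinearMap.range α * LinearMap.range β) : ℝ)

/-- The crux implies it. -/
theorem hbec_of_crux : C → HostingBeatsEveryConstant := by
  rintro ⟨δ, hδ, c, hc, h⟩ K
  have ht : Tendsto (fun n : ℕ => c * (n : ℝ) ^ δ) atTop atTop :=
    Tendsto.const_mul_atTop hc ((tendsto_rpow_atTop hδ).comp tendsto_natCast_atTop_atTop)
  filter_upwards [ht.eventually_ge_atTop K, eventually_ge_atTop 1] with n hK hn1 α β γ hhost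
  have hnpos : (0 : ℝ) < n := by exact_mod_cast (by omega : 0 < n)
  have h1 := h n hn1 α β γ hhost
  have hsplit : (n : ℝ) ^ (2 + δ) = (n : ℝ) ^ (2 : ℝ) * (n : ℝ) ^ δ := Real.rpow_add hnpos 2 δ
  have h2 : (n : ℝ) ^ (2 : ℝ) = (n : ℝ) ^ 2 := by exact_mod_cast Real.rpow_natCast (n : ℝ) 2
  have hsq : (0 : ℝ) ≤ (n : ℝ) ^ 2 := by positivity
  calc K * (n : ℝ) ^ 2 ≤ (c * (n : ℝ) ^ δ) * (n : ℝ) ^ 2 :=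
        mul_le_mul_of_nonneg_right hK hsq
    _ = c * (n : ℝ) ^ (2 + δ) := by rw [hsplit, h2]; ring
    _ ≤ _ := h1

/-- The complementary piece one would need: "no intermediate growth". As a statement it is the
implication `X₁ → C` — the trivial seam BC2(b) rejects. -/
def NoIntermediateGrowth : Prop := HostingBeatsEveryConstant → C

/-- The exact split `C ↔ X₁ ∧ (X₁ → C)`; kernel-trivial, recorded only to show where the seam is. -/
theorem crux_iff_growth_split : C ↔ HostingBeatsEveryConstant ∧ NoIntermediateGrowth :=
  ⟨fun h => ⟨hbec_of_crux h, fun _ => h⟩, fun h => h.2 h.1⟩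

/-! ## §4 The split that passes (a)(b)(c) formally — and lives outside the language (D-N) -/

/-- Piece 1: the extended asymptotic rank conjecture FAILS somewhere — some universal spectral point
exceeds the format at some tensor. Literally the negation of item `AsymptoticSpectrum.FormatBound`
(stmt-8616). A CONSEQUENCE of the crux (below), not conversely: a dark point at some tensor need not
move `ω`. -/
def NotFormatBound : Prop := ¬ AsymptoticSpectrum.FormatBound

/-- Piece 2: MATRIX MULTIPLICATION IS WORST-CASE UNIVERSAL — every universal spectral point is at
most `m^{ω/2}` on every tensor of format `≤ (m,m,m)`, i.e. `σ(d) ≤ σ(MM₂) = ω/2` for all `d`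
(Kaski–Michałek arXiv:2404.06427 §1.1 pose the universality question; Strassen 1988 Prop. 3.6 gives
`σ(d) ≤ 2ω/3`). Implied by the extended asymptotic rank conjecture (`FormatBound`, since `ω ≥ 2`),
consistent with `ω = 2`, hence NOT `≥` the crux; and not implied by it. -/
def MMUniversality : Prop :=
  ∀ F : SpectralMap ℂ, IsUniversalSpectralPoint ℂ F →
    ∀ ⦃ι κ μ : Type⦄ [Fintype ι] [Fintype κ] [Fintype μ] (t : ι → κ → μ → ℂ),
      F t ≤ (max (Fintype.card ι : ℝ) (max (Fintype.card κ : ℝ) (Fintype.card μ : ℝ))) ^ (omega ℂ / 2)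

/-- `FormatBound → MMUniversality` (piece 2 is weaker than the extended asymptotic rank conjecture). -/
theorem mmUniversality_of_formatBound : AsymptoticSpectrum.FormatBound → MMUniversality := by
  intro h F hF ι κ μ _ _ _ t
  have h1 := h F hF t
  set m : ℝ := max (Fintype.card ι : ℝ) (max (Fintype.card κ : ℝ) (Fintype.card μ : ℝ)) with hm
  have hω : 1 ≤ omega ℂ / 2 := by
    have := Literature.CplxAlg.two_le_omega ℂ
    linarith
  have hm0 : 0 ≤ m := le_max_of_le_left (Nat.cast_nonneg _)
  rcases lt_or_ge m 1 with hlt | hge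
  · -- m < 1 forces m = 0 (a max of naturals), and then F t ≤ 0 ≤ 0 ^ _
    have hm0' : m = 0 := by
      have hι : (Fintype.card ι : ℝ) < 1 := lt_of_le_of_lt (le_max_left _ _) hlt
      have hκ : (Fintype.card κ : ℝ) < 1 :=
        lt_of_le_of_lt ((le_max_left _ _).trans (le_max_right _ _)) hlt
      have hμ : (Fintype.card μ : ℝ) < 1 :=
        lt_of_le_of_lt ((le_max_right _ _).trans (le_max_right _ _)) hlt
      have hι0 : Fintype.card ι = 0 := Nat.lt_one_iff.mp (by exact_mod_cast hι)
      have hκ0 : Fintype.card κ = 0 := Nat.lt_one_iff.mp (by exact_mod_cast hκ)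
      have hμ0 : Fintype.card μ = 0 := Nat.lt_one_iff.mp (by exact_mod_cast hμ)
      simp [hm, hι0, hκ0, hμ0]
    rw [hm0'] at h1 ⊢
    exact h1.trans (by rw [Real.zero_rpow (by linarith)])
  · calc F t ≤ m := h1
      _ = m ^ (1 : ℝ) := (Real.rpow_one m).symm
      _ ≤ m ^ (omega ℂ / 2) := Real.rpow_le_rpow_of_exponent_le hge hω

/-- **The assembly of D-N, part 1**: a dark point `F t > m` together with universality
`F t ≤ m^{ω/2}` forces `m < m^{ω/2}`, hence `ω/2 > 1`. -/
theorem two_lt_omega_of_universality_split : NotFormatBound → MMUniversality → 2 < omega ℂ := by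
  intro h1 h2
  by_contra hω
  apply h1
  intro F hF ι κ μ _ _ _ t
  have hle2 : omega ℂ ≤ 2 := not_lt.mp hω
  have heq : omega ℂ = 2 := le_antisymm hle2 (Literature.CplxAlg.two_le_omega ℂ)
  have h := h2 F hF t
  rw [heq, show ((2 : ℝ) / 2) = 1 by norm_num, Real.rpow_one] at h
  exact h

/-- **The assembly of D-N, complete**: `NotFormatBound → MMUniversality → HostingSuperquadratic`,
through `2 < ω(ℂ)` (§4 part 1), `R(⟨n,n,n⟩) ≥ n^ω` (§1) and LowerSandwich (§1). -/
theorem crux_of_universality_split : NotFormatBound → MMUniversality → C :=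
  fun h1 h2 => crux_of_fthesis (fthesis_of_two_lt_omega (two_lt_omega_of_universality_split h1 h2))

/-- Piece 1 is a CONSEQUENCE of the crux, given Strassen duality (a theorem; statement-only fact in
the tree): the maximising spectral point at `⟨2,2,2⟩` reads `R̃(⟨2,2,2⟩) = 2^ω > 4`. -/
theorem notFormatBound_of_two_lt_omega (hdual : strassen_duality_asymptoticRank ℂ) :
    2 < omega ℂ → NotFormatBound := by
  intro hω hFB
  obtain ⟨F, hF, hFt⟩ := (hdual (matMulTensor ℂ 2 2 2)).2
  have h1 := hFB F hF (matMulTensor ℂ 2 2 2)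
  rw [hFt, asymptoticRank_matMulTensor ℂ 2 (by norm_num)] at h1
  have h4 : (4 : ℝ) < (2 : ℝ) ^ omega ℂ := by
    have : (2 : ℝ) ^ (2 : ℝ) < (2 : ℝ) ^ omega ℂ :=
      Real.rpow_lt_rpow_of_exponent_lt (by norm_num) hω
    norm_num at this
    exact this
  have hcard : max (Fintype.card (Fin 2 × Fin 2) : ℝ)
      (max (Fintype.card (Fin 2 × Fin 2) : ℝ) (Fintype.card (Fin 2 × Fin 2) : ℝ)) = 4 := by
    norm_num
  simp only [Nat.cast_ofNat] at h1
  rw [hcard] at h1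
  linarith

/-- Hence the crux implies piece 1 (given duality): `NotFormatBound` is weaker-or-equal; that it is
not `≥` the crux is the (informal) point that a dark spectral point at SOME tensor says nothing about
`⟨2,2,2⟩` without universality. -/
theorem notFormatBound_of_crux (hdual : strassen_duality_asymptoticRank ℂ) : C → NotFormatBound :=
  fun h => notFormatBound_of_two_lt_omega hdual (crux_iff_two_lt_omega.1 h)

/-! ## §5 Typed statements of the remaining census entries (no proofs) -/

/-- Transfer T-b / decomposition D-F: the crux over an arbitrary field `F` (same statement, `F` for
`ℂ`). `ℂ`-hostings spread out to `𝔽̄_ℓ` for almost all `ℓ` (Lefschetz), so the all-large-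
characteristics version is `≥` the crux with fewer tools. -/
def HostingSuperquadraticOver (F : Type) [Field F] : Prop :=
  ∃ δ : ℝ, 0 < δ ∧ ∃ c : ℝ, 0 < c ∧ ∀ n : ℕ, 1 ≤ n →
    ∀ (α β : Matrix (Fin n) (Fin n) F →ₗ[F] Polynomial F) (γ : Polynomial F →ₗ[F] Matrix (Fin n) (Fin n) F),
      (∀ X Y, γ (α X * β Y) = X * Y) →
        c * (n : ℝ) ^ (2 + δ) ≤ (Module.finrank F ↥(LinearMap.range α * LinearMap.range β) : ℝ)

/-- D-F piece 2 as it would have to be typed: the bound in every large positive characteristic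
(prime fields suffice informally). -/
def HostingSuperquadraticLargeChar : Prop :=
  ∃ δ : ℝ, 0 < δ ∧ ∃ c : ℝ, 0 < c ∧ ∀ᶠ p : ℕ in atTop, p.Prime →
    ∀ n : ℕ, 1 ≤ n →
      ∀ (α β : Matrix (Fin n) (Fin n) (ZMod p) →ₗ[ZMod p] Polynomial (ZMod p))
        (γ : Polynomial (ZMod p) →ₗ[ZMod p] Matrix (Fin n) (Fin n) (ZMod p)),
        (∀ X Y, γ (α X * β Y) = X * Y) →
          c * (n : ℝ) ^ (2 + δ) ≤
            (Module.finrank (ZMod p) ↥(LinearMap.range α * LinearMap.range β) : ℝ)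

/-- D-G / Transfer T-d: SYMMETRIC hostings (`α = β`) host only symmetric bilinear maps; the
symmetric shadow of `⟨n,n,n⟩` is the Jordan product `X ∘ Y = XY + YX`, which contains `⟨n/2,n/2,n/2⟩`
(block trick) and is contained in a band of a hosting of `⟨n,n,n⟩` (at the price of `dim V₁² + dim V₂²`,
controlled by the linear Plünnecke inequality, Lecouvey 2014 Thm 3.3). So this is a TRANSFER of the
crux (equivalent up to `δ ↦ O(δ)`), whose why-easier (inverse theorems for SQUARES `A·A` are theorems:
Vosper, `3k − 4` = Couvreur–Zémor 2024) bites at the rungs, not at the exponent. -/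
def SymmetricJordanHostingSuperquadratic : Prop :=
  ∃ δ : ℝ, 0 < δ ∧ ∃ c : ℝ, 0 < c ∧ ∀ n : ℕ, 1 ≤ n →
    ∀ (α : Matrix (Fin n) (Fin n) ℂ →ₗ[ℂ] ℂ[X]) (γ : ℂ[X] →ₗ[ℂ] Matrix (Fin n) (Fin n) ℂ),
      (∀ X Y, γ (α X * α Y) = X * Y + Y * X) →
        c * (n : ℝ) ^ (2 + δ) ≤ (Module.finrank ℂ ↥(LinearMap.range α * LinearMap.range α) : ℝ)

/-- Transfer T-a target / D-B sub-case: MONOMIAL hostings (both spaces spanned by monomials) — the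
function-field copy of "abelian-group hosts": `X_d Y_e` depends only on `d + e`. Plausibly provable
(`≥ c·n³`-type, by the intertwining/Cayley–Hamilton argument of the census), hence NOT load-bearing:
the universal (interpolated) class is never monomial. -/
def MonomialHostingSuperquadratic : Prop :=
  ∃ δ : ℝ, 0 < δ ∧ ∃ c : ℝ, 0 < c ∧ ∀ n : ℕ, 1 ≤ n →
    ∀ (α β : Matrix (Fin n) (Fin n) ℂ →ₗ[ℂ] ℂ[X]) (γ : ℂ[X] →ₗ[ℂ] Matrix (Fin n) (Fin n) ℂ),
      (∀ X Y, γ (α X * β Y) = X * Y) →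
        (∃ D₁ : Finset ℕ, LinearMap.range α = Submodule.span ℂ ((fun d => (Polynomial.X : ℂ[X]) ^ d) '' ↑D₁)) →
        (∃ D₂ : Finset ℕ, LinearMap.range β = Submodule.span ℂ ((fun d => (Polynomial.X : ℂ[X]) ^ d) '' ↑D₂)) →
          c * (n : ℝ) ^ (2 + δ) ≤ (Module.finrank ℂ ↥(LinearMap.range α * LinearMap.range β) : ℝ)

/-- Strengthen S-1: an INCREMENT LAW in `n` (the only genuinely inductive strengthening): each step is
a superquadratic-type bound for a single tensor beyond every catalogued cap — the crux per step. -/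
def HostingIncrementLaw : Prop :=
  ∃ δ : ℝ, 0 < δ ∧ ∃ c : ℝ, 0 < c ∧ ∀ n : ℕ, 1 ≤ n →
    ∀ (α β : Matrix (Fin (n + 1)) (Fin (n + 1)) ℂ →ₗ[ℂ] ℂ[X])
      (γ : ℂ[X] →ₗ[ℂ] Matrix (Fin (n + 1)) (Fin (n + 1)) ℂ),
      (∀ X Y, γ (α X * β Y) = X * Y) →
        (tensorRank (matMulTensor ℂ n n n) : ℝ) + c * (n : ℝ) ^ (1 + δ) ≤
          (Module.finrank ℂ ↥(LinearMap.range α * LinearMap.range β) : ℝ)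

end Summit.MatrixMultiplication.MatrixMultiplication.Cruxes.HostingSuperquadratic.Strategist

end
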